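import Literature.Probability.RandomPlanarGeometry.HexParafermionProofs
import Literature.Probability.RandomPlanarGeometry.HexSAWModes
import HarnessLib

/-!
# First arrivals, loops and departures of the SAW parafermionic observable at a vertex (definitions, transport)

Topic `Literature/Probability/RandomPlanarGeometry`. Source: H. Duminil-Copin, S. Smirnov, *The connective
constant of the honeycomb lattice equals `√(2+√2)`*, Ann. of Math. 175 (2012), 1653–1665 (arXiv:1007.0575),
§2, proof of Lemma 1: the walks ending at the three mid-edges `p, q, r` of a vertex `v` are split into those
"visiting only one mid-edge" (arriving at `v` for the first time), those "visiting all three mid-edges" (a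
path plus a loop through `v`) and those "visiting exactly two mid-edges" (passing through `v`: the one-step
prolongations of the first arrivals, "grouped in triplets").

## Contents (namespace `Literature.Probability.RandomPlanarGeometry.SAW`)

* `firstArrivalObservable`, `loopArrivalObservable`, `departureObservable Λ a x σ v t` — the three parts of
  `F(a, {v,t}, x, σ)` according to the last vertex of the walk (`≠ v` and `v` unvisited / `≠ v` and `v`
  visited earlier / `= v`); `hexParafermionicObservable_eq_parts` (their sum is `F`).
* transport to the coordinate model of `HexSAWObservable.lean`: `sum_ite_weight_eq_sum_pwt` (the coding
  `γ ↦ wOut :: Φ(γ) ++ [Φ e]` of `HexParafermionProofs` restricted to any pair of corresponding classes),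
  whence `departureObservable_eq`, `firstArrivalObservable_eq`, `loopArrivalObservable_eq`: at `x = x_c`,
  `σ = 5/8` the three parts are the sums of `pwt` over `clsOut`, `clsIn`, `clsLoop` of `Φ v` with the
  final dart on `{Φ v, Φ t}`; `edir_chart` (`edir (Φ v) (Φ t) = 2α (mid{v,t} - v)`), `sum_split_three`
  (splitting a class over the three neighbours), `adj_of_mem_clsOut`, `adj_of_mem_clsLoop`.

Deliberately NOT here: the mode identities themselves (`HexParafermionModeIdentities.lean`: departures are
fixed multiples of first arrivals in the sum mode and in the conjugate-direction mode, by `HexSAWModes`).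
-/


noncomputable section

open Finset Literature.Probability.LatticeModels Literature.Probability.Percolation

namespace Literature.Probability.RandomPlanarGeometry.SAW

/-! ### The three parts of the observable at a mid-edge of `v` -/

/-- **First arrivals at `v` along `{v, t}`**: the part of `F(a, {v,t}, x, σ)` carried by the walks whose
last vertex is not `v` and which never visited `v` ("walks visiting only one mid-edge" of `v`; the
trivial walk, present when `{v, t} = a`, counts here). [cite: DuminilCopinSmirnov2012, proof of Lemma 1] -/
def firstArrivalObservable (Λ : Finset HexVertex) (a : Sym2 HexVertex) (x σ : ℝ) (v t : HexVertex) : ℂ :=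
  ∑ γ : HexMidEdgeSAW Λ a s(v, t),
    if γ.verts.getLast? ≠ some v ∧ v ∉ γ.verts then γ.weight x σ else 0

/-- **Loop arrivals at `v` along `{v, t}`**: the part of `F(a, {v,t}, x, σ)` carried by the walks whose
last vertex is not `v` but which visited `v` earlier ("walks visiting all three mid-edges": a path plus a
loop through `v`). [cite: DuminilCopinSmirnov2012, proof of Lemma 1] -/
def loopArrivalObservable (Λ : Finset HexVertex) (a : Sym2 HexVertex) (x σ : ℝ) (v t : HexVertex) : ℂ :=
  ∑ γ : HexMidEdgeSAW Λ a s(v, t),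
    if γ.verts.getLast? ≠ some v ∧ v ∈ γ.verts then γ.weight x σ else 0

/-- **Departures from `v` along `{v, t}`**: the part of `F(a, {v,t}, x, σ)` carried by the walks whose
last vertex is `v` ("walks visiting exactly two mid-edges": they entered `v` by another mid-edge).
[cite: DuminilCopinSmirnov2012, proof of Lemma 1] -/
def departureObservable (Λ : Finset HexVertex) (a : Sym2 HexVertex) (x σ : ℝ) (v t : HexVertex) : ℂ :=
  ∑ γ : HexMidEdgeSAW Λ a s(v, t), if γ.verts.getLast? = some v then γ.weight x σ else 0

/-- `F = A + L + D`: the three parts exhaust the walks to `{v, t}`. [cite: DuminilCopinSmirnov2012, proof of Lemma 1] -/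
theorem hexParafermionicObservable_eq_parts (Λ : Finset HexVertex) (a : Sym2 HexVertex) (x σ : ℝ)
    (v t : HexVertex) :
    hexParafermionicObservable Λ a x σ s(v, t) =
      firstArrivalObservable Λ a x σ v t + loopArrivalObservable Λ a x σ v t +
        departureObservable Λ a x σ v t := by
  rw [hexParafermionicObservable, firstArrivalObservable, loopArrivalObservable, departureObservable,
    ← sum_add_distrib, ← sum_add_distrib]
  refine sum_congr rfl fun γ _ => ?_
  by_cases h1 : γ.verts.getLast? = some v
  · simp [h1]
  · by_cases h2 : v ∈ γ.verts <;> simp [h1, h2]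

/-! ### Transport to the coordinate model, class by class -/

section Transport

open HV

variable {Λ : Finset HexVertex} {a : Sym2 HexVertex} {u w₁ v t : HexVertex}
  {Φ : hexGraph ≃g hvGraph} {α β : ℂ}

/-- **The coding restricted to a class**: for any class `p` of walks `a → {v,t}` and any class `q` of
coded walks that correspond under the coding `γ ↦ wOut :: Φ(γ) ++ [Φ e]` of `HexParafermionProofs`
(`[wOut, hvOrigin]` for the trivial walk), the `x_c, 5/8`-weights of the walks in `p` sum to the
parafermionic weights of the coded walks in `q` with final dart on `{Φ v, Φ t}`.
[cite: DuminilCopinSmirnov2012, Definition 1] -/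
theorem sum_ite_weight_eq_sum_pwt (ha : a = s(u, w₁)) (hu : u ∉ Λ) (hw₁ : w₁ ∈ Λ)
    (huw : hexGraph.Adj u w₁) (hΦu : Φ u = wOut) (hΦw : Φ w₁ = hvOrigin)
    (haff : ∀ f, emb (pos (Φ f)) = α * hexCenter f + β) (hα : α ≠ 0)
    (hvt : hexGraph.Adj v t) (hv : v ∈ Λ)
    (p : HexMidEdgeSAW Λ a s(v, t) → Prop) [DecidablePred p] (q : List HV → Prop) [DecidablePred q]
    (hpq0 : ∀ γ : HexMidEdgeSAW Λ a s(v, t), γ.verts = [] → (p γ ↔ q [wOut, hvOrigin]))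
    (hpq : ∀ (γ : HexMidEdgeSAW Λ a s(v, t)) (hne : γ.verts ≠ []) (e : HexVertex),
      ((γ.verts.getLast hne = v ∧ e = t) ∨ (γ.verts.getLast hne = t ∧ e = v)) →
        (p γ ↔ q (wOut :: (γ.verts.map Φ ++ [Φ e])))) :
    (∑ γ : HexMidEdgeSAW Λ a s(v, t), if p γ then γ.weight hexCriticalFugacity (5 / 8) else 0) =
      ∑ P ∈ ((midWalks (Λ.map Φ.toEquiv.toEmbedding)).filter
          (fun P => finalDart P = (Φ v, Φ t) ∨ finalDart P = (Φ t, Φ v))).filter q, pwt P := by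
  classical
  rw [← sum_filter]
  refine Finset.sum_bij (fun γ _ => if h : γ.verts = [] then [wOut, hvOrigin]
      else wOut :: (γ.verts.map Φ ++ [Φ (if γ.verts.getLast h = v then t else v)]))
    (fun γ hγ => ?_) (fun γ₁ _ γ₂ _ h => ?_) (fun P hP => ?_) (fun γ _ => ?_)
  · -- the code is a walk with the right final dart, in the class `q`
    have hp : p γ := (mem_filter.1 hγ).2
    by_cases h : γ.verts = []
    · rw [dif_pos h, mem_filter, mem_filter, mem_midWalks_iff]
      refine ⟨⟨isMidWalk_trivial _, ?_⟩, (hpq0 γ h).1 hp⟩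
      rw [finalDart_trivial, ← hΦu, ← hΦw]
      have haz : s(u, w₁) = s(v, t) := ha ▸ γ.eq_of_nil h
      rcases Sym2.eq_iff.1 haz with ⟨h1, h2⟩ | ⟨h1, h2⟩
      · left; rw [h1, h2]
      · right; rw [h1, h2]
    · rw [dif_neg h, mem_filter, mem_filter, mem_midWalks_iff]
      exact ⟨⟨γ.isMidWalk_code Φ ha hu hΦu hΦw hvt h (γ.ite_spec hvt h),
        γ.finalDart_code h (γ.ite_spec hvt h)⟩, (hpq γ h _ (γ.ite_spec hvt h)).1 hp⟩
  · -- injectivity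
    apply HexMidEdgeSAW.ext
    by_cases h₁ : γ₁.verts = [] <;> by_cases h₂ : γ₂.verts = []
    · rw [h₁, h₂]
    · rw [dif_pos h₁, dif_neg h₂] at h
      have := congrArg List.length h
      simp only [List.length_cons, List.length_append, List.length_map, List.length_nil] at this
      exact absurd (List.eq_nil_of_length_eq_zero (by omega)) h₂
    · rw [dif_neg h₁, dif_pos h₂] at h
      have := congrArg List.length h
      simp only [List.length_cons, List.length_append, List.length_map, List.length_nil] at this
      exact absurd (List.eq_nil_of_length_eq_zero (by omega)) h₁
    · rw [dif_neg h₁, dif_neg h₂] at h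
      have h' := congrArg List.dropLast (List.cons.inj h).2
      rw [List.dropLast_concat, List.dropLast_concat] at h'
      exact List.map_injective_iff.2 Φ.injective h'
  · -- surjectivity
    rw [mem_filter, mem_filter, mem_midWalks_iff] at hP
    obtain ⟨⟨hPm, hfd⟩, hqP⟩ := hP
    by_cases hP0 : P = [wOut, hvOrigin]
    · subst hP0
      have haz : a = s(v, t) := by
        rw [finalDart_trivial] at hfd
        simp only [← hΦu, ← hΦw, Prod.mk.injEq, EmbeddingLike.apply_eq_iff_eq] at hfd
        rw [ha]
        rcases hfd with ⟨h1, h2⟩ | ⟨h1, h2⟩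
        · rw [h1, h2]
        · rw [h1, h2, Sym2.eq_swap]
      have hfst : a ∈ hexDomainMidEdges Λ := by
        refine ⟨?_, w₁, by rw [ha]; exact Sym2.mem_mk_right u w₁, hw₁⟩
        rw [ha]; exact (SimpleGraph.mem_edgeSet hexGraph).2 huw
      set γ₀ : HexMidEdgeSAW Λ a s(v, t) := ⟨[], by simp, List.nodup_nil, List.isChain_nil, by simp,
        by simp, fun _ => haz, fun h => (h rfl).elim, hfst⟩
      refine ⟨γ₀, mem_filter.2 ⟨mem_univ _, (hpq0 γ₀ rfl).2 hqP⟩, ?_⟩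
      rw [dif_pos rfl]
    · obtain ⟨γ, hne, e, he, rfl⟩ :=
        exists_code_eq ha hu hw₁ huw hΦu hΦw hvt hv hPm hP0 hfd
      refine ⟨γ, mem_filter.2 ⟨mem_univ _, (hpq γ hne e he).2 hqP⟩, ?_⟩
      rw [dif_neg hne]
      congr 3
      rcases he with ⟨h1, h2⟩ | ⟨h1, h2⟩
      · rw [if_pos h1, h2]
      · rw [if_neg (by rw [h1]; exact hvt.ne.symm), h2]
  · -- the weights agree
    by_cases h : γ.verts = []
    · rw [dif_pos h]
      simp [HexMidEdgeSAW.weight, HexMidEdgeSAW.winding, HexMidEdgeSAW.points,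
        HexMidEdgeSAW.length, h, pwt]
    · rw [dif_neg h]
      exact γ.weight_eq_pwt ha hu hΦu hΦw hvt haff hα h (γ.ite_spec hvt h)

/-- In the code of a nontrivial walk the first dart component is `Φ` of the last vertex, and the inner
vertices are `Φ` of the visited vertices. [folklore] -/
theorem code_finalDart_fst_inner (γ : HexMidEdgeSAW Λ a s(v, t)) (hne : γ.verts ≠ []) (e : HexVertex) :
    (finalDart (wOut :: (γ.verts.map Φ ++ [Φ e]))).1 = Φ (γ.verts.getLast hne) ∧
      (finalDart (wOut :: (γ.verts.map Φ ++ [Φ e]))).2 = Φ e ∧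
        inner (wOut :: (γ.verts.map Φ ++ [Φ e])) = γ.verts.map Φ := by
  have hne' : γ.verts.map Φ ≠ [] := by simpa using hne
  rw [finalDart_cons_append hne', List.getLast_map hne', inner_cons_append]
  exact ⟨rfl, rfl, rfl⟩

/-- The last vertex of a nontrivial walk to `{v, t}` is `v` iff `getLast? = some v`. [folklore] -/
theorem getLast?_eq_some_iff (γ : HexMidEdgeSAW Λ a s(v, t)) (hne : γ.verts ≠ []) (x : HexVertex) :
    γ.verts.getLast? = some x ↔ γ.verts.getLast hne = x := by
  rw [List.getLast?_eq_some_getLast hne, Option.some.injEq]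

/-- **Departures, transported**: at `x = x_c`, `σ = 5/8` the departures along `{v, t}` are the coded walks
leaving `Φ v` towards `Φ t` (class `clsOut`). [cite: DuminilCopinSmirnov2012, proof of Lemma 1] -/
theorem departureObservable_eq (ha : a = s(u, w₁)) (hu : u ∉ Λ) (hw₁ : w₁ ∈ Λ)
    (huw : hexGraph.Adj u w₁) (hΦu : Φ u = wOut) (hΦw : Φ w₁ = hvOrigin)
    (haff : ∀ f, emb (pos (Φ f)) = α * hexCenter f + β) (hα : α ≠ 0)
    (hvt : hexGraph.Adj v t) (hv : v ∈ Λ) :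
    departureObservable Λ a hexCriticalFugacity (5 / 8) v t =
      ∑ P ∈ (clsOut (Λ.map Φ.toEquiv.toEmbedding) (Φ v)).filter (fun P => (finalDart P).2 = Φ t),
        pwt P := by
  classical
  have key := sum_ite_weight_eq_sum_pwt ha hu hw₁ huw hΦu hΦw haff hα hvt hv
    (fun γ => γ.verts.getLast? = some v) (fun P => (finalDart P).1 = Φ v) ?_ ?_
  · rw [departureObservable]
    refine (sum_congr rfl fun γ _ => if_congr Iff.rfl rfl rfl).trans (key.trans (sum_congr ?_ fun _ _ => rfl))
    ext P
    simp only [mem_filter, clsOut, mem_midWalks_iff]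
    constructor
    · rintro ⟨⟨hP, hfd⟩, h1⟩
      refine ⟨⟨hP, h1⟩, ?_⟩
      rcases hfd with h | h
      · rw [h]
      · rw [h] at h1; exact absurd (Φ.injective h1) hvt.ne.symm
    · rintro ⟨⟨hP, h1⟩, h2⟩
      exact ⟨⟨hP, Or.inl (Prod.ext h1 h2)⟩, h1⟩
  · intro γ h
    rw [h, finalDart_trivial, ← hΦu]
    simp only [List.getLast?_nil, reduceCtorEq, false_iff]
    intro huv
    apply hu
    rw [Φ.injective huv]
    exact hv
  · intro γ hne e he
    obtain ⟨h1, -, -⟩ := code_finalDart_fst_inner (Φ := Φ) γ hne e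
    rw [h1, getLast?_eq_some_iff γ hne]
    rcases he with ⟨hl, -⟩ | ⟨hl, -⟩
    · rw [hl]; simp
    · rw [hl]
      simp only [EmbeddingLike.apply_eq_iff_eq]

/-- **First arrivals, transported**: at `x = x_c`, `σ = 5/8` the first arrivals along `{v, t}` are the
coded walks arriving at `Φ v` from `Φ t`, `Φ v` not an inner vertex (class `clsIn`).
[cite: DuminilCopinSmirnov2012, proof of Lemma 1] -/
theorem firstArrivalObservable_eq (ha : a = s(u, w₁)) (hu : u ∉ Λ) (hw₁ : w₁ ∈ Λ)
    (huw : hexGraph.Adj u w₁) (hΦu : Φ u = wOut) (hΦw : Φ w₁ = hvOrigin)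
    (haff : ∀ f, emb (pos (Φ f)) = α * hexCenter f + β) (hα : α ≠ 0)
    (hvt : hexGraph.Adj v t) (hv : v ∈ Λ) :
    firstArrivalObservable Λ a hexCriticalFugacity (5 / 8) v t =
      ∑ P ∈ (clsIn (Λ.map Φ.toEquiv.toEmbedding) (Φ v)).filter (fun P => (finalDart P).1 = Φ t),
        pwt P := by
  classical
  have key := sum_ite_weight_eq_sum_pwt ha hu hw₁ huw hΦu hΦw haff hα hvt hv
    (fun γ => γ.verts.getLast? ≠ some v ∧ v ∉ γ.verts)
    (fun P => (finalDart P).2 = Φ v ∧ Φ v ∉ inner P) ?_ ?_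
  · rw [firstArrivalObservable]
    refine (sum_congr rfl fun γ _ => if_congr Iff.rfl rfl rfl).trans (key.trans (sum_congr ?_ fun _ _ => rfl))
    ext P
    simp only [mem_filter, clsIn, mem_midWalks_iff]
    constructor
    · rintro ⟨⟨hP, hfd⟩, h2, hi⟩
      refine ⟨⟨hP, h2, hi⟩, ?_⟩
      rcases hfd with h | h
      · rw [h] at h2; exact absurd (Φ.injective h2) hvt.ne.symm
      · rw [h]
    · rintro ⟨⟨hP, h2, hi⟩, h1⟩
      exact ⟨⟨hP, Or.inr (Prod.ext h1 h2)⟩, h2, hi⟩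
  · intro γ h
    have haz : s(u, w₁) = s(v, t) := ha ▸ γ.eq_of_nil h
    have hvw : v = w₁ := by
      rcases Sym2.eq_iff.1 haz with ⟨h1, -⟩ | ⟨-, h2⟩
      · exact absurd (h1 ▸ hv) hu
      · exact h2.symm
    have htriv : Φ v = hvOrigin := (congrArg Φ hvw).trans hΦw
    simp [h, htriv, HV.inner]
  · intro γ hne e he
    obtain ⟨-, h2, hi⟩ := code_finalDart_fst_inner (Φ := Φ) γ hne e
    rcases he with ⟨hl, he⟩ | ⟨hl, he⟩ <;> subst he <;>
      simp [h2, hi, getLast?_eq_some_iff γ hne, hl, hvt.ne.symm, List.mem_map_of_injective Φ.injective]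

/-- **Loop arrivals, transported**: at `x = x_c`, `σ = 5/8` the loop arrivals along `{v, t}` are the
coded walks arriving at `Φ v` from `Φ t` with `Φ v` an inner vertex (class `clsLoop`).
[cite: DuminilCopinSmirnov2012, proof of Lemma 1] -/
theorem loopArrivalObservable_eq (ha : a = s(u, w₁)) (hu : u ∉ Λ) (hw₁ : w₁ ∈ Λ)
    (huw : hexGraph.Adj u w₁) (hΦu : Φ u = wOut) (hΦw : Φ w₁ = hvOrigin)
    (haff : ∀ f, emb (pos (Φ f)) = α * hexCenter f + β) (hα : α ≠ 0)
    (hvt : hexGraph.Adj v t) (hv : v ∈ Λ) :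
    loopArrivalObservable Λ a hexCriticalFugacity (5 / 8) v t =
      ∑ P ∈ (clsLoop (Λ.map Φ.toEquiv.toEmbedding) (Φ v)).filter (fun P => (finalDart P).1 = Φ t),
        pwt P := by
  classical
  have key := sum_ite_weight_eq_sum_pwt ha hu hw₁ huw hΦu hΦw haff hα hvt hv
    (fun γ => γ.verts.getLast? ≠ some v ∧ v ∈ γ.verts)
    (fun P => (finalDart P).2 = Φ v ∧ Φ v ∈ inner P) ?_ ?_
  · rw [loopArrivalObservable]
    refine (sum_congr rfl fun γ _ => if_congr Iff.rfl rfl rfl).trans (key.trans (sum_congr ?_ fun _ _ => rfl))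
    ext P
    simp only [mem_filter, clsLoop, mem_midWalks_iff]
    constructor
    · rintro ⟨⟨hP, hfd⟩, h2, hi⟩
      refine ⟨⟨hP, h2, hi⟩, ?_⟩
      rcases hfd with h | h
      · rw [h] at h2; exact absurd (Φ.injective h2) hvt.ne.symm
      · rw [h]
    · rintro ⟨⟨hP, h2, hi⟩, h1⟩
      exact ⟨⟨hP, Or.inr (Prod.ext h1 h2)⟩, h2, hi⟩
  · intro γ h
    simp [h, HV.inner]
  · intro γ hne e he
    obtain ⟨-, h2, hi⟩ := code_finalDart_fst_inner (Φ := Φ) γ hne e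
    rcases he with ⟨hl, he⟩ | ⟨hl, he⟩ <;> subst he <;>
      simp [h2, hi, getLast?_eq_some_iff γ hne, hl, hvt.ne.symm, List.mem_map_of_injective Φ.injective]

/-- The direction of the coded dart `Φ v → Φ t` is `2α (mid{v,t} - v)` for a chart of similarity ratio `α`.
[folklore] -/
theorem edir_chart (haff : ∀ f, emb (pos (Φ f)) = α * hexCenter f + β) (v t : HexVertex) :
    edir (Φ v) (Φ t) = 2 * α * (hexMidpoint s(v, t) - hexCenter v) := by
  rw [edir, emb_sub, haff, haff, hexMidpoint_mk]
  ring

/-- **Splitting a class over the three neighbours**: if `π P` is a neighbour of `x` for every `P ∈ S`, a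
sum of `c (π P) · pwt P` over `S` splits along the three neighbours `y₁, y₂, y₃` of `x`. [folklore] -/
theorem sum_split_three {S : Finset (List HV)} {π : List HV → HV} {x y₁ y₂ y₃ : HV} (c : HV → ℂ)
    (h₁ : hvGraph.Adj x y₁) (h₂ : hvGraph.Adj x y₂) (h₃ : hvGraph.Adj x y₃) (h₁₂ : y₁ ≠ y₂)
    (h₂₃ : y₂ ≠ y₃) (h₁₃ : y₁ ≠ y₃) (hS : ∀ P ∈ S, hvGraph.Adj x (π P)) :
    ∑ P ∈ S, c (π P) * pwt P =
      c y₁ * ∑ P ∈ S.filter (fun P => π P = y₁), pwt P +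
        c y₂ * ∑ P ∈ S.filter (fun P => π P = y₂), pwt P +
          c y₃ * ∑ P ∈ S.filter (fun P => π P = y₃), pwt P := by
  classical
  rw [sum_filter, sum_filter, sum_filter, mul_sum, mul_sum, mul_sum, ← sum_add_distrib, ← sum_add_distrib]
  refine sum_congr rfl fun P hP => ?_
  rcases eq_or_eq_or_eq_of_adj h₁ h₂ h₃ h₁₂ h₂₃ h₁₃ (hS P hP) with h | h | h
  · rw [h, if_pos rfl, if_neg h₁₂, if_neg h₁₃]; ring
  · rw [h, if_neg h₁₂.symm, if_pos rfl, if_neg h₂₃]; ring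
  · rw [h, if_neg h₁₃.symm, if_neg h₂₃.symm, if_pos rfl]; ring

/-- Departures leave `Φ v` along an edge. [folklore] -/
theorem adj_of_mem_clsOut {V : Finset HV} {x : HV} {P : List HV} (hP : P ∈ clsOut V x) :
    hvGraph.Adj x (finalDart P).2 := by
  rw [clsOut, mem_filter, mem_midWalks_iff] at hP
  exact hP.2 ▸ hP.1.adj_finalDart

/-- Loop arrivals reach `Φ v` along an edge. [folklore] -/
theorem adj_of_mem_clsLoop {V : Finset HV} {x : HV} {P : List HV} (hP : P ∈ clsLoop V x) :
    hvGraph.Adj x (finalDart P).1 := by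
  rw [clsLoop, mem_filter, mem_midWalks_iff] at hP
  exact hP.2.1 ▸ hP.1.adj_finalDart.symm

end Transport

end Literature.Probability.RandomPlanarGeometry.SAW

end
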